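import Literature.Probability.FitznerVanDerHofstad2017.Stage1TailsST10   -- HOME draft typed/p13/Stage1TailsST10Q_DRAFT.lean (imports the composite `Stage1CellsST10` = typed/p13/Stage1CellsST10Q_DRAFT.lean; module names TBD by the Level-C lead)
import Literature.Probability.FitznerVanDerHofstad2017.Stage1MonoCore    -- HOME draft typed/p13/Stage1MonoCore_DRAFT.lean (typer g10, PART 1)
import HarnessLib

/-!
# HOME DRAFT (pub-lace10 typer g10, 2026-08-23; NOT filed — lead RULING D29 (3)) — inventory §2 A7 / LEVELC-TASKS P2.1′, PART 2 (d-generic, over the ST10′ composite):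
# `Stage1MonotoneInCounts` — THE TYPED ST10′ STAGE-1 RECIPE (`DataQ.inpRmST` + closed-form tails `Stage1Tails.Rem.ST10.inpMajQ`) IS MONOTONE IN THE COUNT TABLES

STATEMENT (STRUCTURE.md §5 C-2a, the (δ)-instance VALIDITY CONSUMER of inventory §2 A7, in `BetaMap.Inputs.Dom` orientation).  For a parameter set `P` (`d ≥ 3`),
slots `ρ`, a [C-22] point hook `χ ≥ 0`, a rational state `y` above the floor (`Γ₁, Γ₂, c_j ≥ 0`), and two rational table instances `E`, `E'` with the SAME initial
cells and `0 ≤ E.tabs ≤ E'.tabs` VALUE BY VALUE (`DataQ.TabLE`), if AT THE LARGER INSTANCE `E'` the two geometric ratios are `< 1` and the ten product brackets of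
cells 36–37 are `≤ 1` (`DataQ.SideN` — finitely many rational inequalities, decidable at a concrete instance), then for any candidate Neumann inverses
`S, S̄ ≥ 1` (entrywise; `SOne`) the sixty-field majorant record moves in the information order:
`(inpMajQ E P ρ χ y s S S̄).Dom (inpMajQmono E' P ρ χ y s S S̄)` (`inpMajQ_mono_tabs`), where `inpMajQmono` is `inpMajQ` with the ONE field that is not
termwise monotone — cell 37-I `ψ^{αI}_{0−1}` (inventory A7 (iv), STRUCTURE N-12) — replaced by its C-21 termwise-monotone MAJORANT `psiAlphaI01MonoRmST`
(row C-21 `psimono`, typer g3 `typed/Stage1PsiMonoC21_DRAFT.lean`, here re-typed over the composite valuation; `E.ψ ≤ E.ψmono ≤ E'.ψmono`).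
ITEMISATION = inventory A7: (i) the 54 `PX`-routed fields — `PX.evalQ_mono_both` under the valuation lemma `valRmST_mono` (the derived atoms `G13at`, `μ̄`,
`μ̄_I`, `hdInv` are increasing in the tables while `g13, ob1 < 1`; the hook `cw 0 ↦ χ` and the state atoms are table-free); (ii)–(iii) `muMin` antitone; the two
cell-[109] ENGINE TEXTS (`--lower engine`, rows C-9…C-12) antitone — they are AFFINE in the letters `Tmax, T3, T2, T11` with non-positive coefficients for `d ≥ 3`
(`EngText.*_anti`, no bracket condition); `pi1Lower` antitone and `psiAlphaII01` monotone under the bracket conditions (verbatim the STATE-direction arguments of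
`Stage1Frame.Data.Std.pi1Lower_anti` / `psiAlphaII01_mono`, now in the TABLE direction); (iv) cell 37-I via C-21; (v) the 22 tail fields — PART 1's
`Stage1Tails.total_mono_ingr` (closed-form reading monotone in the ingredients once `S, S̄ ≥ 1`) on `ingrQ E ≤ ingrQ E'` entrywise.
USE (PART 3, `Stage1MonoST10D10_DRAFT.lean`): at `d = 10`, `(P40, ρ40, χ40, stateRev3)`, `E' := dataN` (the (δ) instance, side conditions DECIDED in the kernel) and
ANY `E ≤ dataN` — in particular the TRUE-COUNT table (the 17 displayed entries := `#sawWordsTo` / `#trailWordsTo`, dominated by the landed NBW majorants) — the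
recipe's outputs at `E` are dominated by the Level-C literals `inputs{I,O}Rev3` (Summits-side PART 4), so the Level-C record can be stated with Assumption 4.3 AT THE
TRUE-COUNT RECIPE OUTPUTS (what Level U proves) instead of at the NBW-majorant instance.
HONEST FRAMING: order bookkeeping over typed HOME-draft texts (LEVELC-CHAIN L2/L3); d-generic; no numeral of record, no table instance, no kernel evaluation, no
theorem about percolation in any dimension; nothing here is a cited fact — `[cite:]` tags are LOCATORS of the notebook cells whose typed texts the lemmas concern.
-/

namespace Literature.Probability.FitznerVanDerHofstad2017
namespace Stage1Cells

open NoGoFrame PX BetaMap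

/-! ## §1 The cell-[109] engine texts are affine and antitone in their letters -/

namespace EngText

/-- the `Tmax`-coefficient of `−psiLowerCellQ`. [cite: FitznerVanDerHofstad2017, Lemma 5.3 (5.25), §6.1 (6.45)–(6.47); notebook Percolation.nb cell [109]] -/
def psiLowerCoefTmax (d : ℕ) (zi zs : ℚ) : ℚ :=
  (2 * (d : ℚ) - 2) * zs ^ 4 * (2 + (2 * (d : ℚ) - 4)) + 2 * ((d : ℚ) - 1) ^ 2 * zs ^ 4
    + 16 * ((d : ℚ) - 1) * ((d : ℚ) - 2) * (2 * (d : ℚ) - 5) * zi ^ 6 * 5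
    + 2 * ((d : ℚ) - 1) * ((d : ℚ) - 2) * zi ^ 6 * (((d : ℚ) - 2) * 80)
    + (3 / 2) * (2 * (d : ℚ) - 2) * (2 * (d : ℚ) - 3) * (2 * (d : ℚ) - 4) * zi ^ 6 * 5

/-- the `T3`-coefficient of `−psiLowerCellQ`. [cite: FitznerVanDerHofstad2017, Lemma 5.3 (5.25), §6.1 (6.45)–(6.47); notebook Percolation.nb cell [109]] -/
def psiLowerCoefT3 (d : ℕ) (zi zs : ℚ) : ℚ :=
  (2 * (d : ℚ) - 2) ^ 2 * zs ^ 4 + 2 * ((d : ℚ) - 1) ^ 2 * zs ^ 4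
    + 16 * ((d : ℚ) - 1) * ((d : ℚ) - 2) * (2 * (d : ℚ) - 5) * zi ^ 6
    + 2 * ((d : ℚ) - 1) * ((d : ℚ) - 2) * zi ^ 6 * (((d : ℚ) - 2) * 16)
    + (3 / 2) * (2 * (d : ℚ) - 2) * (2 * (d : ℚ) - 3) * (2 * (d : ℚ) - 4) * zi ^ 6

/-- the `T2`-coefficient of `−psiLowerCellQ` (and of `−piAlphaLowerCellQ`). [cite: FitznerVanDerHofstad2017, Lemma 5.3 (5.24)–(5.25); notebook Percolation.nb cell [109]] -/
def lowerCoefT2 (d : ℕ) (zs : ℚ) : ℚ := (2 * (d : ℚ) - 2) * zs ^ 4 * 2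

/-- the `T11`-coefficient of `−psiLowerCellQ`. [cite: FitznerVanDerHofstad2017, Lemma 5.3 (5.25); notebook Percolation.nb cell [109]] -/
def psiLowerCoefT11 (d : ℕ) (zs : ℚ) : ℚ :=
  (2 * (d : ℚ) - 2) * zs ^ 4 * (2 * (2 * (d : ℚ) - 3)) + 2 * ((d : ℚ) - 1) ^ 2 * zs ^ 4 * 2

/-- the `Tmax`-coefficient of `−piAlphaLowerCellQ`. [cite: FitznerVanDerHofstad2017, Lemma 5.3 (5.24); notebook Percolation.nb cell [109]] -/
def piAlphaLowerCoefTmax (d : ℕ) (zs : ℚ) : ℚ := (2 * (d : ℚ) - 2) * zs ^ 4 * (2 + (2 * (d : ℚ) - 4))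

/-- the `T3`-coefficient of `−piAlphaLowerCellQ`. [cite: FitznerVanDerHofstad2017, Lemma 5.3 (5.24); notebook Percolation.nb cell [109]] -/
def piAlphaLowerCoefT3 (d : ℕ) (zs : ℚ) : ℚ := (2 * (d : ℚ) - 2) ^ 2 * zs ^ 4

/-- the `T11`-coefficient of `−piAlphaLowerCellQ`. [cite: FitznerVanDerHofstad2017, Lemma 5.3 (5.24); notebook Percolation.nb cell [109]] -/
def piAlphaLowerCoefT11 (d : ℕ) (zs : ℚ) : ℚ := (2 * (d : ℚ) - 2) * zs ^ 4 * (2 * (2 * (d : ℚ) - 3))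

/-- `psiLowerCellQ` is AFFINE in its four letters with the displayed coefficients (difference form). [cite: FitznerVanDerHofstad2017, Lemma 5.3 (5.25), §6.1 (6.45)–(6.47); notebook Percolation.nb cell [109]] -/
theorem psiLowerCellQ_sub (d : ℕ) (zi zs Tmax T3 T2 T11 Tmax' T3' T2' T11' : ℚ) :
    psiLowerCellQ d zi zs Tmax' T3' T2' T11' - psiLowerCellQ d zi zs Tmax T3 T2 T11
      = -(psiLowerCoefTmax d zi zs * (Tmax' - Tmax) + psiLowerCoefT3 d zi zs * (T3' - T3)
          + lowerCoefT2 d zs * (T2' - T2) + psiLowerCoefT11 d zs * (T11' - T11)) := by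
  unfold psiLowerCellQ psiLowerCoefTmax psiLowerCoefT3 lowerCoefT2 psiLowerCoefT11
  ring

/-- `piAlphaLowerCellQ` is AFFINE in its four letters with the displayed coefficients (difference form). [cite: FitznerVanDerHofstad2017, Lemma 5.3 (5.24); notebook Percolation.nb cell [109]] -/
theorem piAlphaLowerCellQ_sub (d : ℕ) (zi zs Tmax T3 T2 T11 Tmax' T3' T2' T11' : ℚ) :
    piAlphaLowerCellQ d zi zs Tmax' T3' T2' T11' - piAlphaLowerCellQ d zi zs Tmax T3 T2 T11
      = -(piAlphaLowerCoefTmax d zs * (Tmax' - Tmax) + piAlphaLowerCoefT3 d zs * (T3' - T3)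
          + lowerCoefT2 d zs * (T2' - T2) + piAlphaLowerCoefT11 d zs * (T11' - T11)) := by
  unfold piAlphaLowerCellQ piAlphaLowerCoefTmax piAlphaLowerCoefT3 lowerCoefT2 piAlphaLowerCoefT11
  ring

section Signs

variable {d : ℕ} {zi zs : ℚ}

/-- the `Tmax`-coefficient of `−psiLowerCellQ` is `≥ 0` for `d ≥ 3`, `z ≥ 0`. [cite: FitznerVanDerHofstad2017, Lemma 5.3 (5.24)–(5.25) (extended version arXiv:1506.07977v1 p. 48); notebook Percolation.nb cell [109]] -/
theorem psiLowerCoefTmax_nonneg (hd : 3 ≤ d) : 0 ≤ psiLowerCoefTmax d zi zs := by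
  have hd' : (3 : ℚ) ≤ d := by exact_mod_cast hd
  unfold psiLowerCoefTmax
  have h1 : 0 ≤ 2 * (d : ℚ) - 2 := by linarith
  have h2 : 0 ≤ 2 * (d : ℚ) - 3 := by linarith
  have h3 : 0 ≤ 2 * (d : ℚ) - 4 := by linarith
  have h4 : 0 ≤ 2 * (d : ℚ) - 5 := by linarith
  have h5 : 0 ≤ (d : ℚ) - 1 := by linarith
  have h6 : 0 ≤ (d : ℚ) - 2 := by linarith
  positivity

/-- the `T3`-coefficient of `−psiLowerCellQ` is `≥ 0` for `d ≥ 3`, `z ≥ 0`. [cite: FitznerVanDerHofstad2017, Lemma 5.3 (5.24)–(5.25) (extended version arXiv:1506.07977v1 p. 48); notebook Percolation.nb cell [109]] -/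
theorem psiLowerCoefT3_nonneg (hd : 3 ≤ d) : 0 ≤ psiLowerCoefT3 d zi zs := by
  have hd' : (3 : ℚ) ≤ d := by exact_mod_cast hd
  unfold psiLowerCoefT3
  have h1 : 0 ≤ 2 * (d : ℚ) - 2 := by linarith
  have h2 : 0 ≤ 2 * (d : ℚ) - 3 := by linarith
  have h3 : 0 ≤ 2 * (d : ℚ) - 4 := by linarith
  have h4 : 0 ≤ 2 * (d : ℚ) - 5 := by linarith
  have h5 : 0 ≤ (d : ℚ) - 1 := by linarith
  have h6 : 0 ≤ (d : ℚ) - 2 := by linarith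
  positivity

/-- the `T2`-coefficient is `≥ 0` for `d ≥ 1`, `z ≥ 0`. [cite: FitznerVanDerHofstad2017, Lemma 5.3 (5.24)–(5.25) (extended version arXiv:1506.07977v1 p. 48); notebook Percolation.nb cell [109]] -/
theorem lowerCoefT2_nonneg (hd : 1 ≤ d) : 0 ≤ lowerCoefT2 d zs := by
  have hd' : (1 : ℚ) ≤ d := by exact_mod_cast hd
  unfold lowerCoefT2
  have h1 : 0 ≤ 2 * (d : ℚ) - 2 := by linarith
  positivity

/-- the `T11`-coefficient of `−psiLowerCellQ` is `≥ 0` for `d ≥ 2`, `z ≥ 0`. [cite: FitznerVanDerHofstad2017, Lemma 5.3 (5.24)–(5.25) (extended version arXiv:1506.07977v1 p. 48); notebook Percolation.nb cell [109]] -/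
theorem psiLowerCoefT11_nonneg (hd : 2 ≤ d) : 0 ≤ psiLowerCoefT11 d zs := by
  have hd' : (2 : ℚ) ≤ d := by exact_mod_cast hd
  unfold psiLowerCoefT11
  have h1 : 0 ≤ 2 * (d : ℚ) - 2 := by linarith
  have h2 : 0 ≤ 2 * (d : ℚ) - 3 := by linarith
  positivity

/-- the `Tmax`-coefficient of `−piAlphaLowerCellQ` is `≥ 0` for `d ≥ 2`, `z ≥ 0`. [cite: FitznerVanDerHofstad2017, Lemma 5.3 (5.24)–(5.25) (extended version arXiv:1506.07977v1 p. 48); notebook Percolation.nb cell [109]] -/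
theorem piAlphaLowerCoefTmax_nonneg (hd : 2 ≤ d) : 0 ≤ piAlphaLowerCoefTmax d zs := by
  have hd' : (2 : ℚ) ≤ d := by exact_mod_cast hd
  unfold piAlphaLowerCoefTmax
  have h1 : 0 ≤ 2 * (d : ℚ) - 2 := by linarith
  have h3 : 0 ≤ 2 * (d : ℚ) - 4 := by linarith
  positivity

/-- the `T3`-coefficient of `−piAlphaLowerCellQ` is `≥ 0` for `z ≥ 0`. [cite: FitznerVanDerHofstad2017, Lemma 5.3 (5.24)–(5.25) (extended version arXiv:1506.07977v1 p. 48); notebook Percolation.nb cell [109]] -/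
theorem piAlphaLowerCoefT3_nonneg : 0 ≤ piAlphaLowerCoefT3 d zs := by
  unfold piAlphaLowerCoefT3; positivity

/-- the `T11`-coefficient of `−piAlphaLowerCellQ` is `≥ 0` for `d ≥ 2`, `z ≥ 0`. [cite: FitznerVanDerHofstad2017, Lemma 5.3 (5.24)–(5.25) (extended version arXiv:1506.07977v1 p. 48); notebook Percolation.nb cell [109]] -/
theorem piAlphaLowerCoefT11_nonneg (hd : 2 ≤ d) : 0 ≤ piAlphaLowerCoefT11 d zs := by
  have hd' : (2 : ℚ) ≤ d := by exact_mod_cast hd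
  unfold piAlphaLowerCoefT11
  have h1 : 0 ≤ 2 * (d : ℚ) - 2 := by linarith
  have h2 : 0 ≤ 2 * (d : ℚ) - 3 := by linarith
  positivity

end Signs

/-- **`psiLowerCellQ` is ANTITONE in its letters** (`d ≥ 3`, `z[i], z[s] ≥ 0`): larger `Tmax, T3, T2, T11` give a smaller lower bound. [cite: FitznerVanDerHofstad2017, Lemma 5.3 (5.25), §6.1 (6.45)–(6.47); notebook Percolation.nb cell [109]] -/
theorem psiLowerCellQ_anti {d : ℕ} (hd : 3 ≤ d) {zi zs : ℚ}
    {Tmax T3 T2 T11 Tmax' T3' T2' T11' : ℚ} (h1 : Tmax ≤ Tmax') (h2 : T3 ≤ T3') (h3 : T2 ≤ T2') (h4 : T11 ≤ T11') :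
    psiLowerCellQ d zi zs Tmax' T3' T2' T11' ≤ psiLowerCellQ d zi zs Tmax T3 T2 T11 := by
  have e := psiLowerCellQ_sub d zi zs Tmax T3 T2 T11 Tmax' T3' T2' T11'
  have c1 := mul_nonneg (psiLowerCoefTmax_nonneg (zi := zi) (zs := zs) hd) (sub_nonneg.2 h1)
  have c2 := mul_nonneg (psiLowerCoefT3_nonneg (zi := zi) (zs := zs) hd) (sub_nonneg.2 h2)
  have c3 := mul_nonneg (lowerCoefT2_nonneg (d := d) (zs := zs) (by omega)) (sub_nonneg.2 h3)
  have c4 := mul_nonneg (psiLowerCoefT11_nonneg (d := d) (zs := zs) (by omega)) (sub_nonneg.2 h4)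
  linarith

/-- **`piAlphaLowerCellQ` is ANTITONE in its letters** (`d ≥ 2`, `z[s] ≥ 0`). [cite: FitznerVanDerHofstad2017, Lemma 5.3 (5.24); notebook Percolation.nb cell [109]] -/
theorem piAlphaLowerCellQ_anti {d : ℕ} (hd : 2 ≤ d) {zi zs : ℚ}
    {Tmax T3 T2 T11 Tmax' T3' T2' T11' : ℚ} (h1 : Tmax ≤ Tmax') (h2 : T3 ≤ T3') (h3 : T2 ≤ T2') (h4 : T11 ≤ T11') :
    piAlphaLowerCellQ d zi zs Tmax' T3' T2' T11' ≤ piAlphaLowerCellQ d zi zs Tmax T3 T2 T11 := by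
  have e := piAlphaLowerCellQ_sub d zi zs Tmax T3 T2 T11 Tmax' T3' T2' T11'
  have c1 := mul_nonneg (piAlphaLowerCoefTmax_nonneg (zs := zs) hd) (sub_nonneg.2 h1)
  have c2 := mul_nonneg (piAlphaLowerCoefT3_nonneg (d := d) (zs := zs)) (sub_nonneg.2 h2)
  have c3 := mul_nonneg (lowerCoefT2_nonneg (d := d) (zs := zs) (by omega)) (sub_nonneg.2 h3)
  have c4 := mul_nonneg (piAlphaLowerCoefT11_nonneg (zs := zs) hd) (sub_nonneg.2 h4)
  linarith

end EngText

/-! ## §2 Hypothesis records -/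

namespace DataQ

/-- TABLE-INSTANCE ORDER `E ≤ E'`: the same six initial cells `boundF3[j,i]`, every table VALUE of `E` (keys `TKey`, incl. the three walk-count differences of
cells 7–8) below that of `E'`, and `E`'s table values `≥ 0` (well-formedness of the smaller instance; the larger one inherits it). [cite: FitznerVanDerHofstad2016NoBLE, App. D pp. 1110–1117 (information order of the bound map)] -/
structure TabLE (E E' : DataQ) (d : ℕ) : Prop where
  ic : E.ic = E'.ic
  le : ∀ k, E.tabs.val d k ≤ E'.tabs.val d k
  nonneg : ∀ k, 0 ≤ E.tabs.val d k

/-- the larger instance's table values are `≥ 0` too. [cite: FitznerVanDerHofstad2016NoBLE, App. D pp. 1110–1117 (information order of the bound map)] -/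
theorem TabLE.nonneg' {E E' : DataQ} {d : ℕ} (H : E.TabLE E' d) : ∀ k, 0 ≤ E'.tabs.val d k :=
  fun k => (H.nonneg k).trans (H.le k)

/-- `TabLE` is reflexive on a well-formed instance. [cite: FitznerVanDerHofstad2016NoBLE, App. D pp. 1110–1117 (information order of the bound map)] -/
theorem TabLE.refl_of_nonneg (E : DataQ) {d : ℕ} (h : ∀ k, 0 ≤ E.tabs.val d k) : E.TabLE E d := ⟨rfl, fun _ => le_rfl, h⟩

/-- THE FLOOR: `d ≥ 3`, the state's `Γ₁, Γ₂, c_j ≥ 0`, the initial cells `≥ 0`, the [C-22] hook `≥ 0` at both points — what makes the basic valuation `≥ 0`. [cite: FitznerVanDerHofstad2016NoBLE, App. D pp. 1110–1117 (information order of the bound map)] -/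
structure Floor (E : DataQ) (P : Params) (χ : Pt → StateQ → ℚ) (y : StateQ) : Prop where
  three_le_d : 3 ≤ P.d
  Gamma1 : 0 ≤ y.Gamma1
  Gamma2 : 0 ≤ y.Gamma2
  c : ∀ j, 0 ≤ y.c j
  ic : ∀ j, 0 ≤ E.ic j
  chi : ∀ s, 0 ≤ χ s y

/-- THE SIDE CONDITIONS AT THE LARGER INSTANCE (finitely many rational inequalities, `decide +kernel` at a concrete instance): the two geometric ratios
`Bound[G,{1},3,t] < 1` (both points) and `Bound[OpenBubble,1,s] < 1`, and the ten product-bracket arguments of cells 36–37 `≤ 1`, over the ST10′ composite.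
[cite: FitznerVanDerHofstad2017, notebook Percolation.nb cells 5, 12, 36–37 (transcript l.237–241, 419–429, 1013–1055)] -/
structure SideN (E : DataQ) (P : Params) (ρ : Fin 10 → T) (χ : Pt → StateQ → ℚ) (y : StateQ) : Prop where
  g13 : ∀ t, E.g13Rm P ρ t y < 1
  ob1 : ∀ s, E.ob1RmST P ρ s y < 1
  br3a : ∀ s, E.evRmST P ρ χ s y (Rem.pi1Br3a P ρ) ≤ 1
  br3b : ∀ s, E.evRmST P ρ χ s y (Rem.pi1Br3b P ρ) ≤ 1
  br4a : ∀ s, E.evRmST P ρ χ s y (Rem.pi1Br4a P ρ) ≤ 1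
  br4b : ∀ s, E.evRmST P ρ χ s y (Rem.pi1Br4b P ρ) ≤ 1
  br5a : ∀ s, E.evRmST P ρ χ s y (Rem.pi1Br5a P ρ) ≤ 1
  br5b : ∀ s, E.evRmST P ρ χ s y (Rem.pi1Br5b P ρ) ≤ 1
  brIA : ∀ s, E.evRmST P ρ χ s y (Rem.PsiAlphaI01brA P ρ) ≤ 1
  brIB : ∀ s, E.evRmST P ρ χ s y (Rem.PsiAlphaI01brB P ρ) ≤ 1
  brIIA : ∀ s, E.evRmST P ρ χ s y (Rem.PsiAlphaII01brA P ρ) ≤ 1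
  brIIB : ∀ s, E.evRmST P ρ χ s y (Rem.PsiAlphaII01brB P ρ) ≤ 1

/-- the three hypothesis records bundled: `E ≤ E'` in the tables, floor and side conditions at `E'`. [cite: FitznerVanDerHofstad2016NoBLE, App. D pp. 1110–1117 (information order of the bound map)] -/
structure MonoHyp (E E' : DataQ) (P : Params) (ρ : Fin 10 → T) (χ : Pt → StateQ → ℚ) (y : StateQ) : Prop where
  tab : E.TabLE E' P.d
  floor : E'.Floor P χ y
  side : E'.SideN P ρ χ y

/-- candidate Neumann inverses at the point `s` that are `≥ 0` and `≥ 1` entrywise (every certificate `(1 − B²)S = 1`, `B, S ≥ 0` gives this: `SOne.one_le_of_certQ`). [cite: FitznerVanDerHofstad2016NoBLE, App. D pp. 1110–1117 (information order of the bound map)] -/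
structure SOne (S Sb : Pt → Matrix (Fin 3) (Fin 3) ℚ) (s : Pt) : Prop where
  S0 : ∀ i j, 0 ≤ S s i j
  S1 : ∀ i j, (1 : Matrix (Fin 3) (Fin 3) ℚ) i j ≤ S s i j
  Sb0 : ∀ i j, 0 ≤ Sb s i j
  Sb1 : ∀ i j, (1 : Matrix (Fin 3) (Fin 3) ℚ) i j ≤ Sb s i j

/-- `S ≥ 1` entrywise from a rational Neumann certificate `(1 − A)·S = 1`, `A, S ≥ 0` (`S = 1 + A·S`). [cite: FitznerVanDerHofstad2016NoBLE, App. D pp. 1110–1117 (information order of the bound map)] -/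
theorem SOne.one_le_of_certQ {n : Type*} [Fintype n] [DecidableEq n] {A S : Matrix n n ℚ} (hA : ∀ i j, 0 ≤ A i j)
    (hS0 : ∀ i j, 0 ≤ S i j) (hS : (1 - A) * S = 1) : ∀ i j, (1 : Matrix n n ℚ) i j ≤ S i j := by
  have hS' : S = 1 + A * S := by
    have h := hS; rw [Matrix.sub_mul, Matrix.one_mul] at h
    rw [← h]; abel
  intro i j
  have hAS : 0 ≤ (A * S) i j := by
    rw [Matrix.mul_apply]; exact Finset.sum_nonneg fun l _ => mul_nonneg (hA i l) (hS0 l j)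
  have := congrFun (congrFun hS' i) j
  rw [Matrix.add_apply] at this
  linarith

/-! ## §3 The basic valuation does not see the tables; the floor makes it `≥ 0` -/

/-- two instances with the same initial cells have the same basic valuation. [cite: FitznerVanDerHofstad2017, notebook Percolation.nb cells 3–10, 12, 39 (transcript l.171–363, 419–429, 1098–1106)] -/
theorem val0_congr {E E' : DataQ} (hic : E.ic = E'.ic) (P : Params) (s : Pt) (y : StateQ) : E.val0 P s y = E'.val0 P s y := by
  funext a
  cases a <;> cases s <;> first | rfl | simp only [DataQ.val0, DataQ.cAt, hic]

section FloorFacts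

variable {E : DataQ} {P : Params} {χ : Pt → StateQ → ℚ} {y : StateQ}

/-- `1 ≤ d`. [cite: FitznerVanDerHofstad2017, notebook Percolation.nb cells 3–10, 12, 39 (transcript l.171–363, 419–429, 1098–1106)] -/
theorem Floor.one_le_d (F : E.Floor P χ y) : 1 ≤ P.d := le_trans (by norm_num) F.three_le_d

/-- `2 ≤ d`. [cite: FitznerVanDerHofstad2017, notebook Percolation.nb cells 3–10, 12, 39 (transcript l.171–363, 419–429, 1098–1106)] -/
theorem Floor.two_le_d (F : E.Floor P χ y) : 2 ≤ P.d := le_trans (by norm_num) F.three_le_d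

/-- `0 ≤ 2d − 2` over `ℚ`. [cite: FitznerVanDerHofstad2017, notebook Percolation.nb cells 3–10, 12, 39 (transcript l.171–363, 419–429, 1098–1106)] -/
theorem Floor.two_dQ_sub_two_nonneg (F : E.Floor P χ y) : 0 ≤ 2 * dQ P - 2 := by
  have : (2 : ℚ) ≤ P.d := by exact_mod_cast F.two_le_d
  simp only [dQ]; linarith

/-- `z[s] ≥ 0`. [cite: FitznerVanDerHofstad2017, notebook Percolation.nb cells 3–10, 12, 39 (transcript l.171–363, 419–429, 1098–1106)] -/
theorem Floor.zAtQ_nonneg (F : E.Floor P χ y) : ∀ s, 0 ≤ zAtQ P s y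
  | .i => le_of_lt (one_div_pos.2 (two_dQ_sub_one_pos F.one_le_d))
  | .o => div_nonneg F.Gamma1 (two_dQ_sub_one_pos F.one_le_d).le

/-- `VarGamma2[s] ≥ 0`. [cite: FitznerVanDerHofstad2017, notebook Percolation.nb cells 3–10, 12, 39 (transcript l.171–363, 419–429, 1098–1106)] -/
theorem Floor.VAtQ_nonneg (F : E.Floor P χ y) : ∀ s, 0 ≤ VAtQ P s y
  | .i => div_nonneg F.two_dQ_sub_two_nonneg (two_dQ_sub_one_pos F.one_le_d).le
  | .o => mul_nonneg F.Gamma2 (div_nonneg F.two_dQ_sub_two_nonneg (two_dQ_sub_one_pos F.one_le_d).le)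

/-- the basic valuation is `≥ 0` above the floor. [cite: FitznerVanDerHofstad2017, notebook Percolation.nb cells 3–10, 12, 39 (transcript l.171–363, 419–429, 1098–1106)] -/
theorem Floor.val0_nonneg (F : E.Floor P χ y) (s : Pt) : ∀ a, 0 ≤ E.val0 P s y a
  | .z => F.zAtQ_nonneg s
  | .V => F.VAtQ_nonneg s
  | .cw j => match s with
    | .i => F.ic j
    | .o => F.c j
  | .Vo => F.VAtQ_nonneg .o
  | .G13at _ => le_rfl
  | .mubOverMu => le_rfl
  | .mubOverMuI => le_rfl
  | .hdInv => le_rfl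

/-- the floor transfers along equal initial cells. [cite: FitznerVanDerHofstad2017, notebook Percolation.nb cells 3–10, 12, 39 (transcript l.171–363, 419–429, 1098–1106)] -/
theorem Floor.of_ic {E' : DataQ} (F : E'.Floor P χ y) (hic : E.ic = E'.ic) : E.Floor P χ y :=
  { F with ic := fun j => by rw [hic]; exact F.ic j }

end FloorFacts

/-! ## §4 Monotonicity of the valuations and of every cell in the tables -/

section Mono

variable {E E' : DataQ} {P : Params} {ρ : Fin 10 → T} {χ : Pt → StateQ → ℚ} {y : StateQ}

namespace MonoHyp

variable (M : MonoHyp E E' P ρ χ y)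
include M

/-- floor at the smaller instance. [cite: FitznerVanDerHofstad2017, notebook Percolation.nb cells 3–10, 12, 39 (transcript l.171–363, 419–429, 1098–1106)] -/
theorem floorE : E.Floor P χ y := M.floor.of_ic M.tab.ic

/-- basic valuation: monotone in the tables (it is equal) — evaluation under it is monotone. [cite: FitznerVanDerHofstad2017, notebook Percolation.nb cells 3–10] -/
theorem ev0_mono (s : Pt) (e : T) : E.ev0 P s y e ≤ E'.ev0 P s y e := by
  unfold DataQ.ev0; rw [val0_congr M.tab.ic]
  exact evalQ_mono_tab (M.floor.val0_nonneg s) M.tab.nonneg M.tab.le e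

/-- evaluation under the basic valuation is `≥ 0` (smaller instance). [cite: FitznerVanDerHofstad2017, notebook Percolation.nb cells 3–10, 12, 39 (transcript l.171–363, 419–429, 1098–1106)] -/
theorem ev0_nonneg (s : Pt) (e : T) : 0 ≤ E.ev0 P s y e := evalQ_nonneg (M.floorE.val0_nonneg s) M.tab.nonneg e

/-- evaluation under the basic valuation is `≥ 0` (larger instance). [cite: FitznerVanDerHofstad2017, notebook Percolation.nb cells 3–10, 12, 39 (transcript l.171–363, 419–429, 1098–1106)] -/
theorem ev0_nonneg' (s : Pt) (e : T) : 0 ≤ E'.ev0 P s y e := evalQ_nonneg (M.floor.val0_nonneg s) M.tab.nonneg' e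

/-- `Bound[G,{1},3,t]` is monotone in the tables. [cite: FitznerVanDerHofstad2017, notebook Percolation.nb cell 5] -/
theorem g13_mono (t : Pt) : E.g13Rm P ρ t y ≤ E'.g13Rm P ρ t y := M.ev0_mono t _

/-- `Bound[G,{1},3,t] ≥ 0` (smaller instance). [cite: FitznerVanDerHofstad2017, notebook Percolation.nb cells 3–10, 12, 39 (transcript l.171–363, 419–429, 1098–1106)] -/
theorem g13_nonneg (t : Pt) : 0 ≤ E.g13Rm P ρ t y := M.ev0_nonneg t _

/-- `Bound[G,{1},3,t] ≥ 0` (larger instance). [cite: FitznerVanDerHofstad2017, notebook Percolation.nb cells 3–10, 12, 39 (transcript l.171–363, 419–429, 1098–1106)] -/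
theorem g13_nonneg' (t : Pt) : 0 ≤ E'.g13Rm P ρ t y := M.ev0_nonneg' t _

/-- `Bound[G,{1},3,t] < 1` at the smaller instance. [cite: FitznerVanDerHofstad2017, notebook Percolation.nb cells 3–10, 12, 39 (transcript l.171–363, 419–429, 1098–1106)] -/
theorem g13_lt (t : Pt) : E.g13Rm P ρ t y < 1 := (M.g13_mono t).trans_lt (M.side.g13 t)

/-- `Bound[OpenBubble,1,s]` (composite) is monotone in the tables. [cite: FitznerVanDerHofstad2017, notebook Percolation.nb cell 12] -/
theorem ob1_mono (s : Pt) : E.ob1RmST P ρ s y ≤ E'.ob1RmST P ρ s y := M.ev0_mono s _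

/-- `Bound[OpenBubble,1,s] < 1` at the smaller instance. [cite: FitznerVanDerHofstad2017, notebook Percolation.nb cells 3–10, 12, 39 (transcript l.171–363, 419–429, 1098–1106)] -/
theorem ob1_lt (s : Pt) : E.ob1RmST P ρ s y < 1 := (M.ob1_mono s).trans_lt (M.side.ob1 s)

/-- the FULL composite valuation is `≥ 0` (smaller instance). [cite: FitznerVanDerHofstad2017, notebook Percolation.nb cells 3–10, 12, 39 (transcript l.171–363, 419–429, 1098–1106)] -/
theorem valRmST_nonneg (s : Pt) : ∀ a, 0 ≤ E.valRmST P ρ χ s y a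
  | .G13at t => M.g13_nonneg t
  | .mubOverMu => inv_one_sub_nonnegQ (M.g13_lt s)
  | .mubOverMuI => inv_one_sub_nonnegQ (M.g13_lt .i)
  | .hdInv => inv_one_sub_nonnegQ (M.ob1_lt s)
  | .cw j => by
      simp only [DataQ.valRmST]; split_ifs
      · exact M.floor.chi s
      · exact M.floorE.val0_nonneg s _
  | .z => M.floorE.val0_nonneg s .z
  | .V => M.floorE.val0_nonneg s .V
  | .Vo => M.floorE.val0_nonneg s .Vo

/-- the FULL composite valuation is `≥ 0` (larger instance). [cite: FitznerVanDerHofstad2017, notebook Percolation.nb cells 3–10, 12, 39 (transcript l.171–363, 419–429, 1098–1106)] -/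
theorem valRmST_nonneg' (s : Pt) : ∀ a, 0 ≤ E'.valRmST P ρ χ s y a
  | .G13at t => M.g13_nonneg' t
  | .mubOverMu => inv_one_sub_nonnegQ (M.side.g13 s)
  | .mubOverMuI => inv_one_sub_nonnegQ (M.side.g13 .i)
  | .hdInv => inv_one_sub_nonnegQ (M.side.ob1 s)
  | .cw j => by
      simp only [DataQ.valRmST]; split_ifs
      · exact M.floor.chi s
      · exact M.floor.val0_nonneg s _
  | .z => M.floor.val0_nonneg s .z
  | .V => M.floor.val0_nonneg s .V
  | .Vo => M.floor.val0_nonneg s .Vo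

/-- **the FULL composite valuation is monotone in the tables** (derived atoms `G13at`, `μ̄`, `μ̄_I`, `hdInv` increase while the ratios stay `< 1`; the hook and the
state atoms are table-free). [cite: FitznerVanDerHofstad2017, notebook Percolation.nb cells 5, 10, 12, 39] -/
theorem valRmST_mono (s : Pt) : ∀ a, E.valRmST P ρ χ s y a ≤ E'.valRmST P ρ χ s y a
  | .G13at t => M.g13_mono t
  | .mubOverMu => inv_one_sub_monoQ (M.g13_mono s) (M.side.g13 s)
  | .mubOverMuI => inv_one_sub_monoQ (M.g13_mono .i) (M.side.g13 .i)
  | .hdInv => inv_one_sub_monoQ (M.ob1_mono s) (M.side.ob1 s)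
  | .cw j => by
      simp only [DataQ.valRmST]; split_ifs
      · exact le_rfl
      · rw [val0_congr M.tab.ic]
  | .z => by show E.val0 P s y .z ≤ E'.val0 P s y .z; rw [val0_congr M.tab.ic]
  | .V => by show E.val0 P s y .V ≤ E'.val0 P s y .V; rw [val0_congr M.tab.ic]
  | .Vo => by show E.val0 P s y .Vo ≤ E'.val0 P s y .Vo; rw [val0_congr M.tab.ic]

/-- **EVERY CELL OF THE COMPOSITE IS MONOTONE IN THE TABLES** (A7 (i): `PX.evalQ_mono_both`). [cite: FitznerVanDerHofstad2017, notebook Percolation.nb cells 3–44] -/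
theorem ev_mono (s : Pt) (e : T) : E.evRmST P ρ χ s y e ≤ E'.evRmST P ρ χ s y e :=
  evalQ_mono_both (M.valRmST_nonneg s) (M.valRmST_mono s) M.tab.nonneg M.tab.le e

/-- every cell is `≥ 0` (smaller instance). [cite: FitznerVanDerHofstad2017, notebook Percolation.nb cells 3–10, 12, 39 (transcript l.171–363, 419–429, 1098–1106)] -/
theorem ev_nonneg (s : Pt) (e : T) : 0 ≤ E.evRmST P ρ χ s y e := evalQ_nonneg (M.valRmST_nonneg s) M.tab.nonneg e

/-- every cell is `≥ 0` (larger instance). [cite: FitznerVanDerHofstad2017, notebook Percolation.nb cells 3–10, 12, 39 (transcript l.171–363, 419–429, 1098–1106)] -/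
theorem ev_nonneg' (s : Pt) (e : T) : 0 ≤ E'.evRmST P ρ χ s y e := evalQ_nonneg (M.valRmST_nonneg' s) M.tab.nonneg' e

/-! ### the hand-typed fields -/

/-- `mumin[s]` is ANTITONE in the tables (A7 (iii)). [cite: FitznerVanDerHofstad2017, notebook Percolation.nb cell 44 (transcript l.1214–1216)] -/
theorem muMin_anti (s : Pt) : E'.muMinRmST P ρ s y ≤ E.muMinRmST P ρ s y := by
  unfold DataQ.muMinRmST
  have h := max_le_max (M.g13_mono s) (M.g13_mono .i)
  exact mul_le_mul_of_nonneg_left (by linarith) (zIrQ_nonneg M.floor.one_le_d)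

omit M in
/-- the atom `z[s]` evaluates to the table-free `zAtQ`. [cite: FitznerVanDerHofstad2017, notebook Percolation.nb cell 3] -/
theorem evRmST_z (E : DataQ) (s : Pt) : E.evRmST P ρ χ s y z = zAtQ P s y := by
  simp only [DataQ.evRmST, z, evalQ_atom]; rfl

/-- `Bound[Pi,alpha,lower,0,s]` (engine text, row C-9/C-10 binding) is ANTITONE in the tables (A7 (iii); no bracket condition: the text is affine in its letters).
[cite: FitznerVanDerHofstad2017, Lemma 5.3 (5.24) (extended version arXiv:1506.07977v1 p. 48); notebook Percolation.nb cell [109]] -/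
theorem piAlphaLower0_anti (s : Pt) : E'.piAlphaLower0RmST P ρ χ s y ≤ E.piAlphaLower0RmST P ρ χ s y := by
  unfold DataQ.piAlphaLower0RmST
  rw [evRmST_z, evRmST_z]
  exact EngText.piAlphaLowerCellQ_anti M.floor.two_le_d (M.ev_mono s _) (M.ev_mono s _) (M.ev_mono s _) (M.ev_mono s _)

/-- `Bound[Psi,lower,0,s]` (engine text, row C-11/C-12 binding) is ANTITONE in the tables (A7 (iii); `d ≥ 3`).
[cite: FitznerVanDerHofstad2017, Lemma 5.3 (5.25) lines 1–5 (extended version arXiv:1506.07977v1 p. 48), §6.1 (6.45)–(6.47) p. 61; notebook Percolation.nb cell [109]] -/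
theorem psiLower0_anti (s : Pt) : E'.psiLower0RmST P ρ χ s y ≤ E.psiLower0RmST P ρ χ s y := by
  unfold DataQ.psiLower0RmST
  rw [evRmST_z, evRmST_z]
  exact EngText.psiLowerCellQ_anti M.floor.three_le_d (M.ev_mono s _) (M.ev_mono s _) (M.ev_mono s _) (M.ev_mono s _)

/-- `Bound[Pi,1,Lower,s]` is ANTITONE in the tables under the six bracket conditions (A7 (iii); the TABLE-direction twin of `Stage1Frame.Data.Std.pi1Lower_anti`).
[cite: FitznerVanDerHofstad2017, notebook Percolation.nb cell 36 (transcript l.1013–1026)] -/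
theorem pi1Lower_anti (s : Pt) : E'.pi1LowerRmST P ρ χ s y ≤ E.pi1LowerRmST P ρ χ s y := by
  unfold DataQ.pi1LowerRmST
  have hz := zIrQ_nonneg M.floor.one_le_d
  have h1 : 0 ≤ 2 * dQ P - 1 := (two_dQ_sub_one_pos M.floor.one_le_d).le
  have h2 := M.floor.two_dQ_sub_two_nonneg
  have c0 : 0 ≤ (2 * dQ P - 1) * (2 * dQ P - 2) * zIrQ P ^ 5 := by positivity
  have c1 : 0 ≤ (2 * dQ P - 2) * zIrQ P ^ 5 := by positivity
  have Mv := fun e => M.ev_mono s e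
  have h0 := mul_le_mul_of_nonneg_left (sub_le_sub_left (Mv (Rem.pi1Br0 P ρ)) 1) c0
  have h2' := mul_le_mul_of_nonneg_left (Mv (Rem.pi1T2 P ρ)) c1
  have h3 := mul_le_mul_of_nonneg_left
    (prod_antiQ (Mv (Rem.pi1Br3a P ρ)) (Mv (Rem.pi1Br3b P ρ)) (M.side.br3a s) (M.side.br3b s)) (K4Q_nonneg M.floor.two_le_d)
  have h4 := mul_le_mul_of_nonneg_left
    (prod_antiQ (Mv (Rem.pi1Br4a P ρ)) (Mv (Rem.pi1Br4b P ρ)) (M.side.br4a s) (M.side.br4b s)) (K4Q_nonneg M.floor.two_le_d)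
  have h5 := mul_le_mul_of_nonneg_left
    (prod_antiQ (Mv (Rem.pi1Br5a P ρ)) (Mv (Rem.pi1Br5b P ρ)) (M.side.br5a s) (M.side.br5b s)) (K5Q_nonneg M.floor.two_le_d)
  linarith

/-- `Bound[Psi,alphaII,0−1,AroundZero,s]` is MONOTONE in the tables under its two bracket conditions (A7 (iii); twin of `Std.psiAlphaII01_mono`).
[cite: FitznerVanDerHofstad2017, notebook Percolation.nb cell 37 (transcript l.1035–1055)] -/
theorem psiAlphaII01_mono (s : Pt) : E.psiAlphaII01RmST P ρ χ s y ≤ E'.psiAlphaII01RmST P ρ χ s y := by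
  unfold DataQ.psiAlphaII01RmST
  have Mv := fun e => M.ev_mono s e
  have bA' := M.side.brIIA s
  have bB' := M.side.brIIB s
  have bA := (Mv (Rem.PsiAlphaII01brA P ρ)).trans bA'
  have bB := (Mv (Rem.PsiAlphaII01brB P ρ)).trans bB'
  have hcy := M.ev_nonneg' s (PsiAlphaII01coef P)
  have hp := prod_antiQ (Mv (Rem.PsiAlphaII01brA P ρ)) (Mv (Rem.PsiAlphaII01brB P ρ)) bA' bB'
  have hpx := (prod_memQ (M.ev_nonneg s (Rem.PsiAlphaII01brA P ρ)) bA (M.ev_nonneg s (Rem.PsiAlphaII01brB P ρ)) bB).2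
  have h2 : E.evRmST P ρ χ s y (PsiAlphaII01coef P) *
      (1 - (1 - E.evRmST P ρ χ s y (Rem.PsiAlphaII01brA P ρ)) * (1 - E.evRmST P ρ χ s y (Rem.PsiAlphaII01brB P ρ)))
      ≤ E'.evRmST P ρ χ s y (PsiAlphaII01coef P) *
      (1 - (1 - E'.evRmST P ρ χ s y (Rem.PsiAlphaII01brA P ρ)) * (1 - E'.evRmST P ρ χ s y (Rem.PsiAlphaII01brB P ρ))) :=
    mul_le_mul (Mv _) (by linarith) (by linarith) hcy
  linarith [Mv (Rem.PsiAlphaII01main P ρ)]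

end MonoHyp

/-! ### cell 37-I: the C-21 termwise-monotone majorant over the composite valuation -/

/-- the C-21 MAJORANT of cell 37-I `Bound[Psi,alphaI,0−1,AroundEi,s]` over the ST10′ composite valuation: `⟦main⟧ + 2·⟦coef⟧·(a + b − a·b) − (2d−2)·z_I⁴`,
`a = ⟦brA⟧`, `b = ⟦brB⟧` (text of row C-21 `psimono`, typer g3 `typed/Stage1PsiMonoC21_DRAFT.lean` `DataQ.psiAlphaI01MonoRm` with `evRm ↦ evRmST`).
[cite: FitznerVanDerHofstad2017, notebook Percolation.nb cell 37 (transcript l.1035–1055)] -/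
noncomputable def psiAlphaI01MonoRmST (E : DataQ) (P : Params) (ρ : Fin 10 → T) (χ : Pt → StateQ → ℚ) (s : Pt) (y : StateQ) : ℚ :=
  E.evRmST P ρ χ s y (Rem.PsiAlphaI01main P ρ)
    + 2 * E.evRmST P ρ χ s y (PsiAlphaI01coef P) *
        (E.evRmST P ρ χ s y (Rem.PsiAlphaI01brA P ρ) + E.evRmST P ρ χ s y (Rem.PsiAlphaI01brB P ρ)
          - E.evRmST P ρ χ s y (Rem.PsiAlphaI01brA P ρ) * E.evRmST P ρ χ s y (Rem.PsiAlphaI01brB P ρ))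
    - (2 * dQ P - 2) * zIrQ P ^ 4

/-- C-21: the as-coded cell 37-I is `≤` its majorant, given `(2d−2)·z_I⁴ ≤ ⟦coef⟧`. [cite: FitznerVanDerHofstad2017, notebook Percolation.nb cell 37 (transcript l.1035–1055)] -/
theorem psiAlphaI01RmST_le_mono (E : DataQ) (s : Pt) (hcoef : (2 * dQ P - 2) * zIrQ P ^ 4 ≤ E.evRmST P ρ χ s y (PsiAlphaI01coef P)) :
    E.psiAlphaI01RmST P ρ χ s y ≤ E.psiAlphaI01MonoRmST P ρ χ s y := by
  unfold DataQ.psiAlphaI01RmST psiAlphaI01MonoRmST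
  set c := E.evRmST P ρ χ s y (PsiAlphaI01coef P)
  set a := E.evRmST P ρ χ s y (Rem.PsiAlphaI01brA P ρ)
  set b := E.evRmST P ρ χ s y (Rem.PsiAlphaI01brB P ρ)
  have h : c * (1 - 2 * ((1 - a) * (1 - b))) = 2 * c * (a + b - a * b) - c := by ring
  linarith

/-- the coefficient cell: `(2d−2)·z_I⁴ ≤ ⟦coef⟧ = (2d−2)·μ̄_I·z_I⁴` for `0 ≤ Bound[G,{1},3,i] < 1` (so `μ̄_I ≥ 1`). [cite: FitznerVanDerHofstad2017, notebook Percolation.nb cells 10, 37] -/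
theorem coef_geST (E : DataQ) (s : Pt) (hd : 1 ≤ P.d) (hg0 : 0 ≤ E.g13Rm P ρ .i y) (hg1 : E.g13Rm P ρ .i y < 1) :
    (2 * dQ P - 2) * zIrQ P ^ 4 ≤ E.evRmST P ρ χ s y (PsiAlphaI01coef P) := by
  have hμ : 1 ≤ 1 / (1 - E.g13Rm P ρ .i y) := one_le_inv_one_subQ hg0 hg1
  have h2d1 : ((2 * P.d - 1 : ℕ) : ℚ) = 2 * dQ P - 1 := by
    rw [Nat.cast_sub (by omega), Nat.cast_mul]; norm_num [dQ]
  have h2d2 : ((2 * P.d - 2 : ℕ) : ℚ) = 2 * dQ P - 2 := by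
    rw [Nat.cast_sub (by omega), Nat.cast_mul]; norm_num [dQ]
  have hz : E.evRmST P ρ χ s y (zI P) = zIrQ P := by
    simp only [DataQ.evRmST, zI, zIrQ, evalQ_divN', evalQ_C, Nat.cast_one, h2d1]
  have hc : E.evRmST P ρ χ s y (PsiAlphaI01coef P) = (2 * dQ P - 2) * (1 / (1 - E.g13Rm P ρ .i y)) * zIrQ P ^ 4 := by
    have : E.evRmST P ρ χ s y (PsiAlphaI01coef P)
        = ((2 * P.d - 2 : ℕ) : ℚ) * E.valRmST P ρ χ s y .mubOverMuI * E.evRmST P ρ χ s y (zI P) ^ 4 := by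
      simp only [DataQ.evRmST, PsiAlphaI01coef, evalQ_mul, evalQ_C, evalQ_atom, evalQ_hpow]
    rw [this, hz, h2d2]
    rfl
  rw [hc]
  have hz0 : 0 ≤ zIrQ P ^ 4 := by positivity
  have hd0 : 0 ≤ 2 * dQ P - 2 := by
    have : (1 : ℚ) ≤ P.d := by exact_mod_cast hd
    simp only [dQ]; linarith
  calc (2 * dQ P - 2) * zIrQ P ^ 4 = (2 * dQ P - 2) * 1 * zIrQ P ^ 4 := by ring
    _ ≤ (2 * dQ P - 2) * (1 / (1 - E.g13Rm P ρ .i y)) * zIrQ P ^ 4 := by gcongr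

/-- the bracket `a + b − a·b` is monotone in both arguments on `a′ ≤ 1`, `b ≤ 1`. [cite: FitznerVanDerHofstad2017, notebook Percolation.nb cell 37 (transcript l.1035–1055)] -/
theorem monoBracketQ {a a' b b' : ℚ} (ha : a ≤ a') (hb : b ≤ b') (ha1 : a' ≤ 1) (hb1 : b ≤ 1) :
    a + b - a * b ≤ a' + b' - a' * b' := by
  nlinarith [mul_nonneg (sub_nonneg.2 ha) (sub_nonneg.2 hb1), mul_nonneg (sub_nonneg.2 hb) (sub_nonneg.2 ha1)]

/-- the majorant shape `m + 2c(a + b − ab) − k` is monotone in `(m, c, a, b)` jointly (`c ≥ 0`, brackets in `[0,1]`). [cite: FitznerVanDerHofstad2017, notebook Percolation.nb cell 37 (transcript l.1035–1055)] -/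
theorem monoShapeQ {m m' c c' a a' b b' k : ℚ} (hm : m ≤ m') (hc : c ≤ c') (hc0 : 0 ≤ c) (ha : a ≤ a') (hb : b ≤ b')
    (ha0 : 0 ≤ a) (hb0 : 0 ≤ b) (ha1 : a' ≤ 1) (hb1 : b' ≤ 1) :
    m + 2 * c * (a + b - a * b) - k ≤ m' + 2 * c' * (a' + b' - a' * b') - k := by
  have h1 : a + b - a * b ≤ a' + b' - a' * b' := monoBracketQ ha hb ha1 (hb.trans hb1)
  have h2 : 0 ≤ a' + b' - a' * b' := by nlinarith [ha0.trans ha, hb0.trans hb]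
  nlinarith [mul_le_mul_of_nonneg_left h1 hc0, mul_le_mul_of_nonneg_right hc h2]

namespace MonoHyp

variable (M : MonoHyp E E' P ρ χ y)
include M

/-- the C-21 majorant is MONOTONE in the tables (row C-21's purpose). [cite: FitznerVanDerHofstad2017, notebook Percolation.nb cell 37 (transcript l.1035–1055)] -/
theorem psiAlphaI01Mono_mono (s : Pt) : E.psiAlphaI01MonoRmST P ρ χ s y ≤ E'.psiAlphaI01MonoRmST P ρ χ s y := by
  unfold psiAlphaI01MonoRmST
  have Mv := fun e => M.ev_mono s e
  exact monoShapeQ (Mv _) (Mv _) (M.ev_nonneg s _) (Mv _) (Mv _) (M.ev_nonneg s _) (M.ev_nonneg s _) (M.side.brIA s) (M.side.brIB s)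

/-- **cell 37-I** (A7 (iv)): the as-coded field at the smaller instance is below the C-21 majorant at the larger one. [cite: FitznerVanDerHofstad2017, notebook Percolation.nb cell 37 (transcript l.1035–1055)] -/
theorem psiAlphaI01_le_mono' (s : Pt) : E.psiAlphaI01RmST P ρ χ s y ≤ E'.psiAlphaI01MonoRmST P ρ χ s y :=
  (psiAlphaI01RmST_le_mono E s (coef_geST E s M.floor.one_le_d (M.g13_nonneg .i) (M.g13_lt .i))).trans (M.psiAlphaI01Mono_mono s)

/-- and at one instance: the as-coded field is below its own majorant (used at the larger instance by the literal domination of PART 4). [cite: FitznerVanDerHofstad2017, notebook Percolation.nb cell 37 (transcript l.1035–1055)] -/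
theorem psiAlphaI01_le_mono_self (s : Pt) : E'.psiAlphaI01RmST P ρ χ s y ≤ E'.psiAlphaI01MonoRmST P ρ χ s y :=
  psiAlphaI01RmST_le_mono E' s (coef_geST E' s M.floor.one_le_d (M.g13_nonneg' .i) (M.side.g13 .i))

end MonoHyp

end Mono

end DataQ

end Stage1Cells

/-! ## §5 The tails layer: ingredients monotone, closed-form tail values monotone -/

namespace Stage1Tails.Rem.ST10

open Stage1Cells NoGoFrame BetaMap Stage1Tails

section TailMono

variable {E E' : DataQ} {P : Params} {ρ : Fin 10 → T} {χ : Pt → StateQ → ℚ} {y : StateQ}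

/-- the real ingredients of the composite at the smaller instance are entrywise below those at the larger one. [cite: FitznerVanDerHofstad2017, notebook Percolation.nb cells 41–42 (transcript l.1131–1175)] -/
theorem ingrQ_le (M : DataQ.MonoHyp E E' P ρ χ y) (s : Pt) :
    Stage1Tails.Ingr.LE (ingrQ E P ρ χ s y).cast (ingrQ E' P ρ χ s y).cast where
  u t i := by
    cases t <;> simp only [IngrQ.cast, Function.comp_apply, Rat.coe_castHom, ingrQ, evVQ] <;> exact_mod_cast M.ev_mono s _
  m t i j := by
    cases t <;> simp only [IngrQ.cast, Matrix.map_apply, Rat.coe_castHom, ingrQ, evMQ, Matrix.of_apply] <;>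
      first | exact le_rfl | exact_mod_cast M.ev_mono s _
  w t i := by
    cases t <;> simp only [IngrQ.cast, Function.comp_apply, Rat.coe_castHom, ingrQ, evVQ] <;> exact_mod_cast M.ev_mono s _
  B i j := by
    simp only [IngrQ.cast, Matrix.map_apply, Rat.coe_castHom, ingrQ, evMQ, Matrix.of_apply]; exact_mod_cast M.ev_mono s _
  Bb i j := by
    simp only [IngrQ.cast, Matrix.map_apply, Rat.coe_castHom, ingrQ, evMQ, Matrix.of_apply]; exact_mod_cast M.ev_mono s _

/-- the real ingredients of the composite at the smaller instance are `≥ 0`. [cite: FitznerVanDerHofstad2017, notebook Percolation.nb cells 41–42 (transcript l.1131–1175)] -/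
theorem ingrQ_nonneg (M : DataQ.MonoHyp E E' P ρ χ y) (s : Pt) : (ingrQ E P ρ χ s y).cast.Nonneg where
  u t i := by
    cases t <;> simp only [IngrQ.cast, Function.comp_apply, Rat.coe_castHom, ingrQ, evVQ] <;> exact_mod_cast M.ev_nonneg s _
  m t i j := by
    cases t <;> simp only [IngrQ.cast, Matrix.map_apply, Rat.coe_castHom, ingrQ, evMQ, Matrix.of_apply] <;>
      first | (rw [Matrix.one_apply]; split_ifs <;> simp) | exact_mod_cast M.ev_nonneg s _
  w t i := by
    cases t <;> simp only [IngrQ.cast, Function.comp_apply, Rat.coe_castHom, ingrQ, evVQ] <;> exact_mod_cast M.ev_nonneg s _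
  B i j := by
    simp only [IngrQ.cast, Matrix.map_apply, Rat.coe_castHom, ingrQ, evMQ, Matrix.of_apply]; exact_mod_cast M.ev_nonneg s _
  Bb i j := by
    simp only [IngrQ.cast, Matrix.map_apply, Rat.coe_castHom, ingrQ, evMQ, Matrix.of_apply]; exact_mod_cast M.ev_nonneg s _

/-- `1 ≤ S` entrywise passes through the cast. [cite: FitznerVanDerHofstad2017, notebook Percolation.nb cells 41–42 (transcript l.1131–1175)] -/
theorem one_le_cast {n : Type*} [Fintype n] [DecidableEq n] {S : Matrix n n ℚ} (h : ∀ i j, (1 : Matrix n n ℚ) i j ≤ S i j) :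
    ∀ i j, (1 : Matrix n n ℝ) i j ≤ S.map (Rat.castHom ℝ) i j := by
  intro i j
  have hij := h i j
  simp only [Matrix.map_apply, Rat.coe_castHom, Matrix.one_apply] at hij ⊢
  split_ifs at hij ⊢
  · exact_mod_cast hij
  · exact_mod_cast hij

/-- **the closed-form TAIL VALUES are monotone in the tables** (A7 (v): PART 1's `total_mono_ingr` at `S, S̄ ≥ 1`). [cite: FitznerVanDerHofstad2017, notebook Percolation.nb cells 41–44 (transcript l.1131–1237)] -/
theorem tailValQ_mono (M : DataQ.MonoHyp E E' P ρ χ y) {S Sb : Pt → Matrix (Fin 3) (Fin 3) ℚ} (s : Pt) (hS : DataQ.SOne S Sb s)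
    (l : List Piece) :
    ((tailValQ E P ρ χ y s (S s) (Sb s) l : ℚ) : ℝ) ≤ ((tailValQ E' P ρ χ y s (S s) (Sb s) l : ℚ) : ℝ) := by
  unfold tailValQ
  rw [← total_cast, ← total_cast]
  exact total_mono_ingr (nonneg_cast hS.S0) (one_le_cast hS.S1) (nonneg_cast hS.Sb0) (one_le_cast hS.Sb1)
    (ingrQ_nonneg M s) (ingrQ_le M s) l

end TailMono

/-! ## §6 THE MAJORANT RECORD IS MONOTONE IN THE TABLES (`Stage1MonotoneInCounts`) -/

/-- the comparison target at the LARGER instance: `inpMajQ E'` with the cell-37-I field replaced by its C-21 termwise-monotone majorant (every other field as is).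
[cite: FitznerVanDerHofstad2017, notebook Percolation.nb cells 37, 41–44 (transcript l.1035–1055, 1131–1237)] -/
noncomputable def inpMajQmono (E' : DataQ) (P : Params) (ρ : Fin 10 → T) (χ : Pt → StateQ → ℚ) (y : StateQ) (s : Pt)
    (S Sb : Pt → Matrix (Fin 3) (Fin 3) ℚ) : Inputs :=
  { inpMajQ E' P ρ χ y s S Sb with psiAlphaIZeroMinusOneAroundEi := ((E'.psiAlphaI01MonoRmST P ρ χ s y : ℚ) : ℝ) }

section Main

variable {E E' : DataQ} {P : Params} {ρ : Fin 10 → T} {χ : Pt → StateQ → ℚ} {y : StateQ}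

/-- cast helper. [cite: FitznerVanDerHofstad2016NoBLE, App. D pp. 1110–1117 (information order of the bound map)] -/
private theorem castLE {a b : ℚ} (h : a ≤ b) : ((a : ℚ) : ℝ) ≤ ((b : ℚ) : ℝ) := by exact_mod_cast h

/-- **`Stage1MonotoneInCounts` — THE TYPED ST10′ STAGE-1 RECIPE WITH TAILS IS MONOTONE IN THE COUNT TABLES** (inventory §2 A7 (i)–(v); STRUCTURE.md §5 C-2a):
`E ≤ E'` in the tables, floor + side conditions at `E'`, `S, S̄ ≥ 1` ⟹ `(inpMajQ E …).Dom (inpMajQmono E' …)` — every upper field up, the four lower fields down,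
cell 37-I against its C-21 majorant. [cite: FitznerVanDerHofstad2017, §§4–6; notebook Percolation.nb cell 44 (transcript l.1214–1237)]
[cite: FitznerVanDerHofstad2016NoBLE, App. D pp. 1110–1117 (the information order of the bound map)] -/
theorem inpMajQ_mono_tabs (M : DataQ.MonoHyp E E' P ρ χ y) (s : Pt) {S Sb : Pt → Matrix (Fin 3) (Fin 3) ℚ} (hS : DataQ.SOne S Sb s) :
    (inpMajQ E P ρ χ y s S Sb).Dom (inpMajQmono E' P ρ χ y s S Sb) where
  mu := le_rfl
  muMin := castLE (M.muMin_anti s)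
  mubOverMu := castLE (M.ev_mono s _)
  mub := castLE (M.ev_mono s _)
  xiAlphaOneMinusZeroAtZero := le_rfl
  xiAlphaZeroMinusOneAtZero := le_rfl
  xiAlphaOneMinusZeroAtEi := castLE (M.ev_mono s _)
  xiAlphaZeroMinusOneAtEi := castLE (M.ev_mono s _)
  xiIotaAlphaIAtEi := castLE (M.ev_mono s _)
  xiIotaAlphaIIAtZero := castLE (M.ev_mono s _)
  xiIotaAlphaISumAroundEi := castLE (M.ev_mono s _)
  xiIotaAlphaIISumAroundZero := castLE (M.ev_mono s _)
  psiAlphaIOneMinusZeroAroundEi := castLE (M.ev_mono s _)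
  psiAlphaIIZeroMinusOneAroundZero := castLE (M.psiAlphaII01_mono s)
  psiAlphaIZeroMinusOneAroundEi := castLE (M.psiAlphaI01_le_mono' s)
  psiAlphaIIOneMinusZeroAroundZero := castLE (M.ev_mono s _)
  piAlpha := castLE (M.ev_mono s _)
  piAlphaLower := castLE (M.piAlphaLower0_anti s)
  piOneLower := castLE (M.pi1Lower_anti s)
  psiZeroLower := castLE (M.psiLower0_anti s)
  xiAbs := add_le_add (castLE (M.ev_mono s _)) (add_le_add (tailValQ_mono M s hS _) (tailValQ_mono M s hS _))
  xiOdd := add_le_add (castLE (M.ev_mono s _)) (tailValQ_mono M s hS _)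
  xiEven := add_le_add (castLE (M.ev_mono s _)) (tailValQ_mono M s hS _)
  xiEvenTail := add_le_add (castLE (M.ev_mono s _)) (tailValQ_mono M s hS _)
  xiOddTail := add_le_add (castLE (M.ev_mono s _)) (tailValQ_mono M s hS _)
  xiR0 := castLE (M.ev_mono s _)
  xiR1 := castLE (M.ev_mono s _)
  xiR0Delta := castLE (M.ev_mono s _)
  xiR1Delta := castLE (M.ev_mono s _)
  xiDeltaAbs := add_le_add (castLE (M.ev_mono s _)) (add_le_add (tailValQ_mono M s hS _) (tailValQ_mono M s hS _))
  xiOddDelta := add_le_add (castLE (M.ev_mono s _)) (tailValQ_mono M s hS _)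
  xiEvenDelta := add_le_add (castLE (M.ev_mono s _)) (tailValQ_mono M s hS _)
  xiOddTailDelta := add_le_add (castLE (M.ev_mono s _)) (tailValQ_mono M s hS _)
  xiEvenTailDelta := add_le_add (castLE (M.ev_mono s _)) (tailValQ_mono M s hS _)
  psiRI0 := castLE (M.ev_mono s _)
  psiRI1 := castLE (M.ev_mono s _)
  psiRII0 := castLE (M.ev_mono s _)
  psiRII1 := castLE (M.ev_mono s _)
  psiRI0Delta := castLE (M.ev_mono s _)
  psiRI1Delta := castLE (M.ev_mono s _)
  psiRII0Delta := castLE (M.ev_mono s _)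
  psiRII1Delta := castLE (M.ev_mono s _)
  piR0 := castLE (M.ev_mono s _)
  piR0DeltaEiEk := castLE (M.ev_mono s _)
  xiIotaAbs := add_le_add (castLE (M.ev_mono s _)) (add_le_add (tailValQ_mono M s hS _) (tailValQ_mono M s hS _))
  xiIotaOdd := add_le_add (castLE (M.ev_mono s _)) (tailValQ_mono M s hS _)
  xiIotaEven := add_le_add (castLE (M.ev_mono s _)) (tailValQ_mono M s hS _)
  xiIotaEvenTail := add_le_add (castLE (M.ev_mono s _)) (tailValQ_mono M s hS _)
  xiIotaRI0 := castLE (M.ev_mono s _)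
  xiIotaRII0 := castLE (M.ev_mono s _)
  xiIotaDeltaEi := add_le_add (castLE (M.ev_mono s _)) (add_le_add (tailValQ_mono M s hS _) (tailValQ_mono M s hS _))
  xiIotaOddDeltaEi := add_le_add (castLE (M.ev_mono s _)) (tailValQ_mono M s hS _)
  xiIotaEvenDeltaEi := add_le_add (castLE (M.ev_mono s _)) (tailValQ_mono M s hS _)
  xiIotaEvenTailDeltaEi := add_le_add (castLE (M.ev_mono s _)) (tailValQ_mono M s hS _)
  xiIotaDeltaZero := add_le_add (castLE (M.ev_mono s _)) (add_le_add (tailValQ_mono M s hS _) (tailValQ_mono M s hS _))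
  xiIotaOddDeltaZero := add_le_add (castLE (M.ev_mono s _)) (tailValQ_mono M s hS _)
  xiIotaEvenDeltaZero := add_le_add (castLE (M.ev_mono s _)) (tailValQ_mono M s hS _)
  xiIotaEvenTailDeltaZero := add_le_add (castLE (M.ev_mono s _)) (tailValQ_mono M s hS _)
  xiIotaRI0DeltaEi := castLE (M.ev_mono s _)
  xiIotaRII0DeltaZero := castLE (M.ev_mono s _)

/-- the same against the UNMODIFIED record at the larger instance, for every field except cell 37-I: in particular `inpMajQmono E'` is itself dominated by any
record dominating `inpMajQ E'` whose cell-37-I entry also dominates the C-21 majorant (`Inputs.Dom.update_psiAlphaIZeroMinusOneAroundEi`, PART 1). [cite: FitznerVanDerHofstad2016NoBLE, App. D pp. 1110–1117 (information order of the bound map)] -/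
theorem inpMajQmono_dom_of {s : Pt} {S Sb : Pt → Matrix (Fin 3) (Fin 3) ℚ} {N : Inputs} (h : (inpMajQ E' P ρ χ y s S Sb).Dom N)
    (h37 : ((E'.psiAlphaI01MonoRmST P ρ χ s y : ℚ) : ℝ) ≤ N.psiAlphaIZeroMinusOneAroundEi) : (inpMajQmono E' P ρ χ y s S Sb).Dom N :=
  h.update_psiAlphaIZeroMinusOneAroundEi h37

/-- **COROLLARY (the validity consumer in use)**: if the recipe's majorant record at the LARGER instance `E'` is dominated by a literal table `N` whose cell-37-I entry
also dominates the C-21 majorant at `E'`, then the recipe at EVERY smaller instance `E ≤ E'` is dominated by `N`. [cite: FitznerVanDerHofstad2016NoBLE, App. D pp. 1110–1117] -/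
theorem inpMajQ_dom_of_le (M : DataQ.MonoHyp E E' P ρ χ y) (s : Pt) {S Sb : Pt → Matrix (Fin 3) (Fin 3) ℚ} (hS : DataQ.SOne S Sb s)
    {N : Inputs} (h : (inpMajQ E' P ρ χ y s S Sb).Dom N) (h37 : ((E'.psiAlphaI01MonoRmST P ρ χ s y : ℚ) : ℝ) ≤ N.psiAlphaIZeroMinusOneAroundEi) :
    (inpMajQ E P ρ χ y s S Sb).Dom N :=
  Inputs.Dom.trans (inpMajQ_mono_tabs M s hS) (inpMajQmono_dom_of h h37)

end Main

end Stage1Tails.Rem.ST10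

end Literature.Probability.FitznerVanDerHofstad2017
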